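import Mathlib
import HarnessLib
import Summits.Langlands.Langlands.Theses.SkinnerWilesDefectOne

/-!
# The numerical criterion at a generic point in regular-element form, and the inert-junk obstruction:
# helper for stub `stub_rigidityAtGenericPoint` of line generic-eisenstein-rigidity (crux ReducibleOrdinaryProModular, stmt-Langlands-12919)

Route `SkinnerWilesDefectOne`, line lead's helper file (wave 1, stub-worker output integrated by the lead).  The stub
`stub_rigidityAtGenericPoint` ((P1_η) of the line card: at the generic point `η` of an Eisenstein divisor the
Berger–Klosin / Wiles–Lenstra numerical criterion forces `R̂_η ≅ T̂_P`, hence the minimal prime below `η` is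
pro-modular) has a commutative-algebra core that is kernel-checked here, sorry-free:

* §1 the criterion in REGULAR-ELEMENT form: `ker_eq_bot_of_regular_generator` (R Noetherian, `(x) ≤ Jac R`,
  `φ x` regular, `R/(x) ↪ S/(φ x)` ⇒ `φ` injective), `bijective_of_regular_generator`,
  `span_le_jacobson_bot_of_mem_maximalIdeal`, the counting step `injective_of_surjective_of_length_le`
  (a surjection onto a module of finite length ≥ the length of the source is injective) and the assembled
  `bijective_of_surjective_of_length_le` — the exact shape in which the stub's depth inequality
  `length_R(R_η/I R_η) ≤ length_T(T_P/J T_P)`, the regular element of `J T_P` and the principality `I R_η = (x)`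
  are consumed (re-proved from the crux triage scratch `Cruxes/ReducibleOrdinaryProModular/TriageScratch-r1-1.lean`);
* §2 transfer pieces (SW99 Prop. 4.1 / 8.4, "relations die in `R_η`, hence modulo `𝔮 ⊆ η`"):
  `ker_algebraMap_localization_le`, `exists_comp_eq_of_ker_le`;
* §3 the OBSTRUCTION CORE behind the lead's reshape v5 of the skeleton: `exists_forall_pow_ne` (Krull: a non-zero
  non-unit of a Noetherian local ring is not an `n`-th power for `n ≫ 0`) and `not_exists_of_root` (no admissible map
  extends to `T[y]/(yⁿ − a)` when `a` is forced onto such an element) — the reason the v2 statement of the stub, with a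
  Hecke datum over a FREE weight ring `Λ`, was false whenever instantiated, and why v5 asks trace-density over `𝒪`
  (SW99 Lemma 3.11).

The last theorem `stub_rigidityAtGenericPoint_auxCriterion` is the registered one-line wrapper (sub-goal of
stmt-Langlands-12919) through which this helper file lands.

References: T. Berger, K. Klosin, *On deformation rings of residually reducible Galois representations and R = T
theorems*, Math. Ann. 355 (2013), §5.2 (arXiv:1103.5100 §7, Thm. 49 / Prop. 51); C. M. Skinner, A. J. Wiles,
*Residually reducible representations and modular forms*, Publ. Math. IHÉS 89 (1999), Lemma 3.11, Prop. 4.1, Prop. 8.4.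
-/

set_option linter.dupNamespace false

namespace Summit.Langlands.Langlands.Cruxes.ReducibleOrdinaryProModular.GenericEisensteinRigidity

open IsLocalRing

noncomputable section

/-! ## §1 The Berger–Klosin / Wiles–Lenstra criterion in regular-element form

(adapted from the triage scratch `Cruxes/ReducibleOrdinaryProModular/TriageScratch-r1-1.lean`,
`CruxTriage.ReducibleOrdinaryProModular.*`; re-proved here, not imported) -/

section Criterion

/-- **Generic-point criterion (regular-element form).**  Let `φ : R → S` be a ring map with `R`
Noetherian, `x ∈ Jac(R)`, `φ x` not a zero divisor of `S`, and suppose the induced map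
`R/(x) → S/(φ x)` is injective.  Then `φ` is injective. [folklore] -/
theorem ker_eq_bot_of_regular_generator {R S : Type*} [CommRing R] [CommRing S] [IsNoetherianRing R]
    (φ : R →+* S) (x : R) (hx : Ideal.span {x} ≤ (⊥ : Ideal R).jacobson)
    (hreg : ∀ s : S, φ x * s = 0 → s = 0)
    (h1 : ∀ r : R, φ r ∈ Ideal.span {φ x} → r ∈ Ideal.span {x}) :
    RingHom.ker φ = ⊥ := by
  -- adapted from TriageScratch-r1-1 `ker_eq_bot_of_regular_generator`
  set K : Ideal R := RingHom.ker φ with hK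
  have hfg : K.FG := (isNoetherianRing_iff_ideal_fg R).mp inferInstance K
  have hle : K ≤ Ideal.span {x} • K := by
    intro k hk
    have hk0 : φ k = 0 := hk
    have hkx : k ∈ Ideal.span {x} := h1 k (by simp [hk0])
    obtain ⟨r, rfl⟩ := Ideal.mem_span_singleton'.mp hkx
    have hr : φ r = 0 := by
      apply hreg
      have : φ (r * x) = 0 := hk0
      simpa [map_mul, mul_comm] using this
    have hrK : r ∈ K := hr
    have hxr : x * r ∈ Ideal.span {x} * K :=
      Ideal.mul_mem_mul (Ideal.mem_span_singleton_self x) hrK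
    have : r * x ∈ Ideal.span {x} * K := by simpa [mul_comm] using hxr
    simpa [Ideal.smul_eq_mul] using this
  exact Submodule.eq_bot_of_le_smul_of_le_jacobson_bot (Ideal.span {x}) K hfg hle hx

/-- Surjective version: under the same hypotheses a surjection is an isomorphism. [folklore] -/
theorem bijective_of_regular_generator {R S : Type*} [CommRing R] [CommRing S] [IsNoetherianRing R]
    (φ : R →+* S) (hφ : Function.Surjective φ) (x : R)
    (hx : Ideal.span {x} ≤ (⊥ : Ideal R).jacobson)
    (hreg : ∀ s : S, φ x * s = 0 → s = 0)
    (h1 : ∀ r : R, φ r ∈ Ideal.span {φ x} → r ∈ Ideal.span {x}) :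
    Function.Bijective φ :=
  ⟨(RingHom.injective_iff_ker_eq_bot φ).mpr (ker_eq_bot_of_regular_generator φ x hx hreg h1), hφ⟩

/-- In a local ring every element of the maximal ideal satisfies the Jacobson hypothesis above.
[folklore] -/
theorem span_le_jacobson_bot_of_mem_maximalIdeal {R : Type*} [CommRing R] [IsLocalRing R]
    (x : R) (hx : x ∈ IsLocalRing.maximalIdeal R) :
    Ideal.span {x} ≤ (⊥ : Ideal R).jacobson := by
  rw [IsLocalRing.jacobson_eq_maximalIdeal ⊥ bot_ne_top]
  exact (Ideal.span_singleton_le_iff_mem _).mpr hx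

/-- **Counting step** (the Berger–Klosin length inequality): a surjective linear map onto a module of
finite length at least the length of the source is injective. [folklore] -/
theorem injective_of_surjective_of_length_le {R M P : Type*} [Ring R] [AddCommGroup M] [Module R M]
    [AddCommGroup P] [Module R P] (g : M →ₗ[R] P) (hg : Function.Surjective g)
    (hP : Module.length R P ≠ ⊤) (hle : Module.length R M ≤ Module.length R P) :
    Function.Injective g := by
  -- adapted from TriageScratch-r1-1 `injective_of_surjective_of_length_le`
  have h := Module.length_eq_add_of_exact (LinearMap.ker g).subtype g
    (Submodule.subtype_injective _) hg (LinearMap.exact_subtype_ker_map g)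
  have hM : Module.length R M ≠ ⊤ := ne_top_of_le_ne_top hP hle
  have hK : Module.length R (LinearMap.ker g) ≠ ⊤ :=
    ne_top_of_le_ne_top hM (Module.length_le_of_injective _ (Submodule.subtype_injective _))
  obtain ⟨n, hn⟩ := ENat.ne_top_iff_exists.mp hP
  obtain ⟨m, hm⟩ := ENat.ne_top_iff_exists.mp hM
  obtain ⟨k, hk⟩ := ENat.ne_top_iff_exists.mp hK
  rw [← hn, ← hm, ← hk] at h
  rw [← hn, ← hm] at hle
  have h' : m = k + n := by exact_mod_cast h
  have hle' : m ≤ n := by exact_mod_cast hle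
  have hk0 : k = 0 := by omega
  have hK0 : Module.length R (LinearMap.ker g) = 0 := by rw [← hk, hk0]; rfl
  have hsub : Subsingleton (LinearMap.ker g) := Module.length_eq_zero_iff.mp hK0
  rw [← LinearMap.ker_eq_bot]
  exact Submodule.eq_bot_iff _ |>.mpr fun y hy => by
    have := hsub.elim ⟨y, hy⟩ 0
    simpa using congrArg Subtype.val this

/-- **The numerical criterion at the generic point, assembled** (the form used by the line: local
Noetherian source, surjective `φ`, a generator `x ∈ 𝔪_R` of the reducibility ideal whose image is
`S`-regular, `S/(φ x)` of finite `S`-length at least the `R`-length of `R/(x)`): `φ` is bijective.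
Lengths are taken over the respective rings, as in the registered stub (`Module.length_eq_of_surjective`
identifies them along the surjection). [cite: BergerKlosin2012, §5.2] -/
theorem bijective_of_surjective_of_length_le {R S : Type*} [CommRing R] [CommRing S]
    [IsNoetherianRing R] [IsLocalRing R] (φ : R →+* S) (hφ : Function.Surjective φ)
    (x : R) (hx : x ∈ maximalIdeal R) (hreg : φ x ∈ nonZeroDivisors S)
    (hfin : Module.length S (S ⧸ Ideal.span {φ x}) ≠ ⊤)
    (hle : Module.length R (R ⧸ Ideal.span {x}) ≤ Module.length S (S ⧸ Ideal.span {φ x})) :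
    Function.Bijective φ := by
  letI : Algebra R S := φ.toAlgebra
  have hφ' : Function.Surjective (algebraMap R S) := hφ
  set J : Ideal S := Ideal.span {φ x} with hJ
  -- lengths of `S ⧸ J` over `R`, over `S` and over itself agree
  have hRS : Module.length R (S ⧸ J) = Module.length S (S ⧸ J) := by
    rw [Module.length_eq_of_surjective (S := R) (R := S ⧸ J) (M := S ⧸ J)
        ((Ideal.Quotient.mk_surjective).comp hφ'),
      Module.length_eq_of_surjective (S := S) (R := S ⧸ J) (M := S ⧸ J)
        Ideal.Quotient.mk_surjective]
  -- the induced `R`-linear surjection `R ⧸ (x) → S ⧸ (φ x)`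
  have hIJ : Ideal.span {x} ≤ J.comap (Algebra.ofId R S) := by
    rw [Ideal.span_singleton_le_iff_mem, Ideal.mem_comap]
    exact Ideal.subset_span (Set.mem_singleton _)
  let g : (R ⧸ Ideal.span {x}) →ₐ[R] S ⧸ J := Ideal.quotientMapₐ J (Algebra.ofId R S) hIJ
  have hg : Function.Surjective g := Ideal.quotientMap_surjective (H := hIJ) hφ'
  have hinj : Function.Injective g.toLinearMap :=
    injective_of_surjective_of_length_le g.toLinearMap hg (hRS ▸ hfin) (hRS ▸ hle)
  refine bijective_of_regular_generator φ hφ x (span_le_jacobson_bot_of_mem_maximalIdeal x hx)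
    (fun s hs => (mem_nonZeroDivisors_iff.mp hreg).1 s hs) (fun r hr => ?_)
  have h0 : g (Ideal.Quotient.mk _ r) = 0 := by
    change Ideal.Quotient.mk J (φ r) = 0
    exact Ideal.Quotient.eq_zero_iff_mem.mpr hr
  have : (Ideal.Quotient.mk (Ideal.span {x}) r) = 0 :=
    hinj (by simpa using h0)
  exact Ideal.Quotient.eq_zero_iff_mem.mp this

end Criterion

/-! ## §2 Transfer pieces (SW99 Prop. 4.1 / 8.4: "relations die in `R_η`, hence modulo `𝔮 ⊆ η`") -/

section Transfer

/-- The kernel of `R → R_η` is contained in every prime `𝔮 ⊆ η`. [folklore] -/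
theorem ker_algebraMap_localization_le {R : Type*} [CommRing R] (η : Ideal R) [η.IsPrime]
    (𝔮 : Ideal R) [𝔮.IsPrime] (hle : 𝔮 ≤ η) :
    RingHom.ker (algebraMap R (Localization.AtPrime η)) ≤ 𝔮 := by
  intro r hr
  rw [RingHom.mem_ker, IsLocalization.map_eq_zero_iff η.primeCompl] at hr
  obtain ⟨⟨s, hs⟩, hsr⟩ := hr
  have hs𝔮 : s ∉ 𝔮 := fun h => hs (hle h)
  have hmem : s * r ∈ 𝔮 := by rw [hsr]; exact 𝔮.zero_mem
  exact (Ideal.IsPrime.mem_or_mem ‹𝔮.IsPrime› hmem).resolve_left hs𝔮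

/-- If a ring homomorphism `f : R → S` kills an ideal `𝔞`... the factorisation used to produce
`ϑ : T → R/𝔮` from `T = S/𝔞` once `𝔞 ↦ 0` in `R/𝔮`: a surjection `π : S → T` and a map
`φ : S → R'` with `ker π ≤ ker φ` give `T → R'` compatible with `π`. [folklore] -/
theorem exists_comp_eq_of_ker_le {S T R' : Type*} [CommRing S] [CommRing T] [CommRing R']
    (π : S →+* T) (hπ : Function.Surjective π) (φ : S →+* R') (h : RingHom.ker π ≤ RingHom.ker φ) :
    ∃ ϑ : T →+* R', ϑ.comp π = φ := by
  refine ⟨RingHom.liftOfSurjective π hπ ⟨φ, h⟩, ?_⟩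
  exact RingHom.liftOfRightInverse_comp π _ _ ⟨φ, h⟩

end Transfer

/-! ## §3 Obstruction core (why the registered `∀ H`-statement cannot hold non-vacuously) -/

section Obstruction

/-- In a Noetherian local ring a non-zero element of the maximal ideal is not an `n`-th power for
all large `n` (Krull's intersection theorem). [folklore] -/
theorem exists_forall_pow_ne {B : Type*} [CommRing B] [IsNoetherianRing B] [IsLocalRing B]
    (s : B) (hs : s ∈ maximalIdeal B) (hs0 : s ≠ 0) :
    ∃ n : ℕ, 2 ≤ n ∧ ∀ b : B, b ^ n ≠ s := by
  have hKrull := Ideal.iInf_pow_eq_bot_of_isLocalRing (maximalIdeal B)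
    (maximalIdeal.isMaximal B).ne_top
  have : ¬ ∀ i : ℕ, s ∈ maximalIdeal B ^ i := by
    intro h
    apply hs0
    have : s ∈ (⨅ i : ℕ, maximalIdeal B ^ i) := Ideal.mem_iInf.mpr h
    simpa [hKrull] using this
  push Not at this
  obtain ⟨n, hn⟩ := this
  refine ⟨n + 2, by omega, fun b hb => ?_⟩
  by_cases hbu : IsUnit b
  · exact (IsLocalRing.mem_maximalIdeal _ ).mp hs (hb ▸ hbu.pow _)
  · have hbm : b ∈ maximalIdeal B := hbu
    apply hn
    have : b ^ (n + 2) ∈ maximalIdeal B ^ (n + 2) := Ideal.pow_mem_pow hbm _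
    rw [hb] at this
    exact Ideal.pow_le_pow_right (by omega) this

/-- The obstruction in abstract form: if an element `a` of `T` is sent by EVERY admissible map
`T → B` to a fixed `s` which is not an `n`-th power in `B`, then no admissible map extends to
`T[y]/(yⁿ − a)` — here phrased for any `T`-algebra `T'` containing an `n`-th root of `a`. [folklore] -/
theorem not_exists_of_root {T T' B : Type*} [CommRing T] [CommRing T'] [CommRing B]
    [Algebra T T'] (Adm : (T →+* B) → Prop) (a : T) (s : B) (n : ℕ)
    (hforced : ∀ ϑ₁ : T →+* B, Adm ϑ₁ → ϑ₁ a = s) (hroot : ∃ y : T', y ^ n = algebraMap T T' a)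
    (hs : ∀ b : B, b ^ n ≠ s) :
    ¬ ∃ ϑ : T' →+* B, Adm (ϑ.comp (algebraMap T T')) := by
  rintro ⟨ϑ, hϑ⟩
  obtain ⟨y, hy⟩ := hroot
  refine hs (ϑ y) ?_
  rw [← map_pow, hy, ← RingHom.comp_apply, hforced _ hϑ]

end Obstruction


/-! ## §4 Registered wrapper -/

/-- **Registered wrapper** (sub-goal `stub_rigidityAtGenericPoint_auxCriterion` of stmt-Langlands-12919): the
numerical criterion at the generic point in the assembled local form — a surjection `φ : R → S` from a Noetherian
local ring, a non-unit `x` whose image is `S`-regular with `S/(φ x)` of finite `S`-length at least the `R`-length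
of `R/(x)`, is an isomorphism. [cite: BergerKlosin2012, §5.2] -/
theorem stub_rigidityAtGenericPoint_auxCriterion :
    ∀ (R S : Type) [CommRing R] [CommRing S] [IsNoetherianRing R] [IsLocalRing R] (φ : R →+* S),
      Function.Surjective φ → ∀ x : R, x ∈ maximalIdeal R → φ x ∈ nonZeroDivisors S →
      Module.length S (S ⧸ Ideal.span {φ x}) ≠ ⊤ →
      Module.length R (R ⧸ Ideal.span {x}) ≤ Module.length S (S ⧸ Ideal.span {φ x}) →
      Function.Bijective φ :=
  fun _ _ _ _ _ _ φ hφ x hx hreg hfin hle => bijective_of_surjective_of_length_le φ hφ x hx hreg hfin hle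

end

end Summit.Langlands.Langlands.Cruxes.ReducibleOrdinaryProModular.GenericEisensteinRigidity
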